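import Mathlib
import Literature.MathematicalPhysics.QuantumFieldTheory.Balaban1983to89.B4
import Literature.MathematicalPhysics.QuantumFieldTheory.Balaban1983to89.SchurTest

/-!
# `Balaban1983to89.B6KernelComposition` — composition of exponentially decaying lattice kernels: the rate drops, the
constant stays uniform (B6 = T. Bałaban, *Propagators and renormalization transformations for lattice gauge
theories. II*, Commun. Math. Phys. **96**, 223–250 (1984) [Balaban1984PropagatorsII]; index conventions of [3] = B4 =
[Balaban1983RegularityDecay], Sect. 5, `B4.Idx Ω N = ↥Ω × Fin N`, sup-distance on ℤ^d)

CITATION HEADER (lean-in-tree rule 2026-08-18).  Cell `pub-balaban`, unit `b2b-balaban-b06-g3` (paper sub-cell B06,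
gen 3).  Sibling of `…B6WeightedEncoding` / `…B6FromB4`.  B6 repeatedly composes operators whose kernels decay
exponentially; ONCE the composition is displayed — p. 235 [PDF 13] (render `1984-cmp96-propagators-rt-II-p013-x2.png`),
(2.68) verbatim (first, second and last members): *"|(Q′G′²Q′*)(y, y′)| = |Σ_{y″∈𝔅} (Q′G′Δ(y″)G′Q′*)(y, y′)| ≤ Σ_{y″∈𝔅}
O(1)(L^jη)²e^{−½δ₀d(y,y″)}(L^{j″}η)²(L^{j′}η)^{−d}e^{−½δ₀d(y″,y′)} ≤ … ≤ O(1)(L^jη)⁴(L^{j′}η)^{−d}e^{−¼δ₀d(y,y′)}, (2.68)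
where we have used the inequalities (2.60), (2.63) of Lemma 1."* — two factors of rate ½δ₀ give a composite of rate
¼δ₀, the y″-sum being paid for by the surplus rate; elsewhere it is asserted — census C-B6-3: *"(2.43)–(2.44):
composition of exponentially decaying kernels … ✓"*, and at the [3]-use site (S1), p. 237 [PDF 15] (render
`…-p015-x2.png`), verbatim: *"Of course we have also a bound from above and an exponential decay of the kernel of
Q′G′^ξ(□̃)²Q′* with the decay rate δ₀."* (by (2.68), applied to G′^ξ(□̃), the displayed rate is ¼δ₀ — cell GAPS row
G-b06g3-2: wording, immaterial downstream since only *"a decay rate δ₁ depending on δ₀ and the bound γ₀"* is used).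
THIS MODULE kernel-checks the elementary lattice estimate behind all such steps, with constants UNIFORM in the finite
region Ω ⊂ ℤ^d (which is what the uniformity bookkeeping of `B6FromB4` / `B6WeightedEncoding` needs), and records
precisely why the rate must drop:
* `sum_exp_dist_le` : Σ_{z∈Ω} e^{−a|x−z|} ≤ (2/(1 − e^{−a/d}))^d for every finite Ω ⊂ ℤ^d, x ∈ ℤ^d, a > 0
  (|·| = sup-distance, as in [3] and `B4.Hyp56`);
* `conv_exp_dist_le` : Σ_{z∈Ω} e^{−δ|x−z|}e^{−δ|z−y|} ≤ (2/(1 − e^{−(δ−δ′)/d}))^d · e^{−δ′|x−y|} for 0 ≤ δ′ < δ — the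
  composite decays at ANY SMALLER rate δ′ with a constant depending on (δ − δ′, d) only (the mechanism of (2.68));
* `mul_decay` : for matrices A, B on `B4.Idx Ω N` with |A(p, q)| ≤ c₁e^{−δ|p−q|}, |B(q, r)| ≤ c₂e^{−δ|q−r|}:
  |(AB)(p, r)| ≤ c₁c₂·N·(2/(1 − e^{−(δ−δ′)/d}))^d·e^{−δ′|p−r|}; `mul_decay_of_embedding` : the same for matrices on any
  finite variable set S placed in Ω × Fin N by an injection ι (the setting of `B6WeightedEncoding.WSite`), so that the
  hypothesis field `WSite.Printed.decay` for a composite follows from the decay of its factors; `row_sum_le` /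
  `col_sum_le` : the uniform row/column-sum bounds Σ_q |A(p, q)| ≤ c·N·C(d, δ), and — by the tree's finite Schur
  test `SchurTest.sum_sq_le` — `mulVec_sq_le_of_decay` : ‖Ax‖₂² ≤ (c·N·C(d, δ))²‖x‖₂², the undisplayed "kernel bound ⇒
  operator bound" conversion of B6 §2 (census C-B6-3: *"the kernel→ℓ² (Schur) conversion is not displayed
  (routine)"*), uniform in Ω;
* `conv_prefactor_witness` : Σ_{z=0}^{n} e^{−δz}e^{−δ(n−z)} = (n + 1)e^{−δn} — along a lattice line the composite of
  two rate-δ kernels is EXACTLY (n + 1)e^{−δn} at distance n, so the composite of rate-δ kernels does NOT decay at rate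
  δ with an absolute constant: some rate must be given away, as (2.68) does.

v1.1/v1.2 (2026-08-18, same unit): + §4 `mulVec_sq_le_of_decay` (kernel bound ⇒ ℓ²-operator bound, uniform in Ω, via
the tree's `SchurTest.sum_sq_le`), certifying the second undisplayed routine step named in census C-B6-3; v1.2 drops
v1.1's restatement of the Schur test in favour of the import.  v1 = p179040, v1.1 = p179072.

WHAT IS KERNEL-CHECKED: everything in this file (finite sums, the geometric series Σ qⁿ = (1 − q)⁻¹ from Mathlib, the
triangle inequality of the sup-metric on ℤ^d = `Fin d → ℤ`).  No named fact, no hypothesis structure, nothing of B6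
asserted.  Value = kernel certificate of an elementary step used silently throughout B6 §2, NOT summit progress.
-/

namespace Literature.MathematicalPhysics.QuantumFieldTheory.Balaban1983to89.B6KernelComposition

open Literature.MathematicalPhysics.QuantumFieldTheory.Balaban1983to89
open Finset

/-! ## §1  One-dimensional sums Σ_{m∈T} q^{|m−x|} ≤ 2/(1 − q) -/

section OneDim

/-- The fibre {m ∈ T : |m − x| = n} has at most two elements (x + n and x − n). [folklore] -/
theorem card_fiber_natAbs_le (T : Finset ℤ) (x : ℤ) (n : ℕ) :
    (T.filter fun m => (m - x).natAbs = n).card ≤ 2 := by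
  calc (T.filter fun m => (m - x).natAbs = n).card ≤ ({x + n, x - n} : Finset ℤ).card := by
        refine Finset.card_le_card fun m hm => ?_
        rw [Finset.mem_filter] at hm
        rw [Finset.mem_insert, Finset.mem_singleton]
        rcases Int.natAbs_eq_iff.mp hm.2 with h | h
        · left; omega
        · right; omega
    _ ≤ 2 := Finset.card_le_two

/-- Σ_{m∈T} q^{|m−x|} ≤ 2/(1 − q) for a finite T ⊂ ℤ, x ∈ ℤ, 0 ≤ q < 1 (two geometric series). [folklore] -/
theorem sum_pow_natAbs_le (T : Finset ℤ) (x : ℤ) {q : ℝ} (hq0 : 0 ≤ q) (hq1 : q < 1) :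
    ∑ m ∈ T, q ^ (m - x).natAbs ≤ 2 / (1 - q) := by
  have hsum : ∑ b ∈ T.image (fun m : ℤ => (m - x).natAbs), q ^ b ≤ (1 - q)⁻¹ := by
    rw [← tsum_geometric_of_lt_one hq0 hq1]
    exact Summable.sum_le_tsum _ (fun n _ => pow_nonneg hq0 n) (summable_geometric_of_lt_one hq0 hq1)
  rw [Finset.sum_comp (fun n : ℕ => q ^ n) (fun m : ℤ => (m - x).natAbs)]
  refine (Finset.sum_le_sum (g := fun b => (2 : ℝ) * q ^ b) fun b _ => ?_).trans ?_
  · rw [nsmul_eq_mul]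
    exact mul_le_mul_of_nonneg_right (by exact_mod_cast card_fiber_natAbs_le T x b) (pow_nonneg hq0 b)
  · rw [← Finset.mul_sum, div_eq_mul_inv]
    exact mul_le_mul_of_nonneg_left hsum (by norm_num)

/-- e^{−b|x − m|} = (e^{−b})^{|m − x|} for integers x, m. [folklore] -/
theorem exp_neg_mul_abs_eq_pow (x m : ℤ) (b : ℝ) :
    Real.exp (-(b * |(x : ℝ) - (m : ℝ)|)) = Real.exp (-b) ^ (m - x).natAbs := by
  rw [← Real.exp_nat_mul, Nat.cast_natAbs, Int.cast_abs, Int.cast_sub, abs_sub_comm]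
  congr 1
  ring

/-- Σ_{m∈T} e^{−b|x−m|} ≤ 2/(1 − e^{−b}) for a finite T ⊂ ℤ, x ∈ ℤ, b > 0. [folklore] -/
theorem sum_exp_abs_le (T : Finset ℤ) (x : ℤ) {b : ℝ} (hb : 0 < b) :
    ∑ m ∈ T, Real.exp (-(b * |(x : ℝ) - (m : ℝ)|)) ≤ 2 / (1 - Real.exp (-b)) := by
  have hq1 : Real.exp (-b) < 1 := by
    rw [← Real.exp_zero]
    exact Real.exp_lt_exp.mpr (by linarith)
  simp only [exp_neg_mul_abs_eq_pow]
  exact sum_pow_natAbs_le T x (Real.exp_pos _).le hq1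

end OneDim

/-! ## §2  Lattice sums over a finite region of ℤ^d (sup-distance), uniform in the region -/

section Lattice

variable {d : ℕ}

/-- Σ_i |x_i − z_i| ≤ d·|x − z|_∞. [folklore] -/
theorem sum_coord_dist_le (x z : Fin d → ℤ) : ∑ i, dist (x i) (z i) ≤ d * dist x z := by
  calc ∑ i, dist (x i) (z i) ≤ ∑ _i : Fin d, dist x z := Finset.sum_le_sum fun i _ => dist_le_pi_dist x z i
    _ = d * dist x z := by rw [Finset.sum_const, Finset.card_univ, Fintype.card_fin, nsmul_eq_mul]

/-- e^{−a|x−z|_∞} ≤ Π_i e^{−(a/d)|x_i − z_i|} (a ≥ 0). [folklore] -/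
theorem exp_dist_le_prod (x z : Fin d → ℤ) {a : ℝ} (ha : 0 ≤ a) :
    Real.exp (-(a * dist x z)) ≤ ∏ i, Real.exp (-(a / d * |(x i : ℝ) - (z i : ℝ)|)) := by
  rw [← Real.exp_sum]
  apply Real.exp_le_exp.mpr
  rw [Finset.sum_neg_distrib, neg_le_neg_iff, ← Finset.mul_sum]
  have h1 : ∑ i, |(x i : ℝ) - (z i : ℝ)| = ∑ i, dist (x i) (z i) :=
    Finset.sum_congr rfl fun i _ => (Int.dist_eq (x i) (z i)).symm
  rw [h1]
  rcases Nat.eq_zero_or_pos d with hd | hd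
  · subst hd
    rw [Finset.univ_eq_empty, Finset.sum_empty, mul_zero]
    exact mul_nonneg ha dist_nonneg
  · have hd' : (d : ℝ) ≠ 0 := by exact_mod_cast hd.ne'
    calc a / d * ∑ i, dist (x i) (z i) ≤ a / d * (d * dist x z) :=
          mul_le_mul_of_nonneg_left (sum_coord_dist_le x z) (div_nonneg ha (Nat.cast_nonneg d))
      _ = a * dist x z := by rw [← mul_assoc, div_mul_cancel₀ a hd']

/-- The uniform constant C(d, a) = (2/(1 − e^{−a/d}))^d of the lattice sums below. [folklore] -/
noncomputable def latticeConst (d : ℕ) (a : ℝ) : ℝ := (2 / (1 - Real.exp (-(a / d)))) ^ d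

/-- C(d, a) > 0 for a > 0. [folklore] -/
theorem latticeConst_pos (d : ℕ) {a : ℝ} (ha : 0 < a) : 0 < latticeConst d a := by
  unfold latticeConst
  rcases Nat.eq_zero_or_pos d with hd | hd
  · subst hd
    simp
  · have hq1 : Real.exp (-(a / d)) < 1 := by
      rw [← Real.exp_zero]
      exact Real.exp_lt_exp.mpr (by
        have : 0 < a / d := div_pos ha (by exact_mod_cast hd)
        linarith)
    have : 0 < 1 - Real.exp (-(a / d)) := by linarith
    positivity

/-- 1 ≤ C(d, a) for a > 0 (each factor 2/(1 − q) ≥ 2). [folklore] -/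
theorem one_le_latticeConst (d : ℕ) {a : ℝ} (ha : 0 < a) : 1 ≤ latticeConst d a := by
  unfold latticeConst
  rcases Nat.eq_zero_or_pos d with hd | hd
  · subst hd
    simp
  · have hq0 : 0 < Real.exp (-(a / d)) := Real.exp_pos _
    have hq1 : Real.exp (-(a / d)) < 1 := by
      rw [← Real.exp_zero]
      exact Real.exp_lt_exp.mpr (by
        have : 0 < a / d := div_pos ha (by exact_mod_cast hd)
        linarith)
    have h2 : (1 : ℝ) ≤ 2 / (1 - Real.exp (-(a / d))) := by
      rw [le_div_iff₀ (by linarith)]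
      linarith
    exact one_le_pow₀ h2

/-- KERNEL-CHECKED: Σ_{z∈Ω} e^{−a|x−z|_∞} ≤ (2/(1 − e^{−a/d}))^d for EVERY finite Ω ⊂ ℤ^d, x ∈ ℤ^d, a > 0 — the
constant does not depend on Ω (nor on x). [folklore] -/
theorem sum_exp_dist_le (Ω : Finset (Fin d → ℤ)) (x : Fin d → ℤ) {a : ℝ} (ha : 0 < a) :
    ∑ z ∈ Ω, Real.exp (-(a * dist x z)) ≤ latticeConst d a := by
  classical
  have hg0 : ∀ (i : Fin d) (m : ℤ), 0 ≤ Real.exp (-(a / d * |(x i : ℝ) - (m : ℝ)|)) :=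
    fun i m => (Real.exp_pos _).le
  calc ∑ z ∈ Ω, Real.exp (-(a * dist x z))
      ≤ ∑ z ∈ Ω, ∏ i, Real.exp (-(a / d * |(x i : ℝ) - (z i : ℝ)|)) :=
        Finset.sum_le_sum fun z _ => exp_dist_le_prod x z ha.le
    _ ≤ ∑ z ∈ Fintype.piFinset (fun i => Ω.image fun z : Fin d → ℤ => z i),
          ∏ i, Real.exp (-(a / d * |(x i : ℝ) - (z i : ℝ)|)) := by
        refine Finset.sum_le_sum_of_subset_of_nonneg (fun z hz => ?_)
          (fun z _ _ => Finset.prod_nonneg fun i _ => hg0 i (z i))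
        exact Fintype.mem_piFinset.mpr fun i => Finset.mem_image_of_mem _ hz
    _ = ∏ i, ∑ m ∈ Ω.image (fun z : Fin d → ℤ => z i), Real.exp (-(a / d * |(x i : ℝ) - (m : ℝ)|)) :=
        (Finset.prod_univ_sum (fun i => Ω.image fun z : Fin d → ℤ => z i)
          (fun i m => Real.exp (-(a / d * |(x i : ℝ) - (m : ℝ)|)))).symm
    _ ≤ ∏ _i : Fin d, 2 / (1 - Real.exp (-(a / d))) := by
        refine Finset.prod_le_prod (fun i _ => Finset.sum_nonneg fun m _ => hg0 i m) fun i _ => ?_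
        have hb : 0 < a / d := div_pos ha (by exact_mod_cast Fin.pos i)
        exact sum_exp_abs_le (Ω.image fun z : Fin d → ℤ => z i) (x i) hb
    _ = latticeConst d a := by
        rw [Finset.prod_const, Finset.card_univ, Fintype.card_fin, latticeConst]

/-- KERNEL-CHECKED, THE COMPOSITION ESTIMATE: Σ_{z∈Ω} e^{−δ|x−z|}e^{−δ|z−y|} ≤ C(d, δ − δ′)·e^{−δ′|x−y|} for
0 ≤ δ′ < δ, every finite Ω ⊂ ℤ^d and x, y ∈ ℤ^d — the composite of two rate-δ kernels decays at any smaller rate δ′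
with a constant depending on (d, δ − δ′) only (triangle inequality + `sum_exp_dist_le`). [folklore] -/
theorem conv_exp_dist_le (Ω : Finset (Fin d → ℤ)) (x y : Fin d → ℤ) {δ δ' : ℝ} (hδ' : 0 ≤ δ') (h : δ' < δ) :
    ∑ z ∈ Ω, Real.exp (-(δ * dist x z)) * Real.exp (-(δ * dist z y)) ≤
      latticeConst d (δ - δ') * Real.exp (-(δ' * dist x y)) := by
  have hterm : ∀ z : Fin d → ℤ, Real.exp (-(δ * dist x z)) * Real.exp (-(δ * dist z y)) ≤
      Real.exp (-((δ - δ') * dist x z)) * Real.exp (-(δ' * dist x y)) := by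
    intro z
    rw [← Real.exp_add, ← Real.exp_add]
    apply Real.exp_le_exp.mpr
    have htri := dist_triangle x z y
    have h1 : (0 : ℝ) ≤ dist z y := dist_nonneg
    nlinarith [mul_nonneg hδ' (show (0 : ℝ) ≤ dist x z + dist z y - dist x y by linarith),
      mul_nonneg (sub_nonneg.mpr h.le) h1]
  calc ∑ z ∈ Ω, Real.exp (-(δ * dist x z)) * Real.exp (-(δ * dist z y))
      ≤ ∑ z ∈ Ω, Real.exp (-((δ - δ') * dist x z)) * Real.exp (-(δ' * dist x y)) :=
        Finset.sum_le_sum fun z _ => hterm z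
    _ = (∑ z ∈ Ω, Real.exp (-((δ - δ') * dist x z))) * Real.exp (-(δ' * dist x y)) := by
        rw [Finset.sum_mul]
    _ ≤ latticeConst d (δ - δ') * Real.exp (-(δ' * dist x y)) :=
        mul_le_mul_of_nonneg_right (sum_exp_dist_le Ω x (sub_pos.mpr h)) (Real.exp_pos _).le

/-- KERNEL-CHECKED, SHARPNESS WITNESS: along a lattice line the composite of two rate-δ kernels at distance n is
EXACTLY (n + 1)e^{−δn}: Σ_{z=0}^{n} e^{−δz}e^{−δ(n−z)} = (n + 1)e^{−δn}.  Hence a composite of rate-δ kernels does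
not decay at rate δ with an absolute constant; it does at any rate δ′ < δ (`conv_exp_dist_le`), which is how (2.68)
proceeds (½δ₀ ↦ ¼δ₀) and how p. 237's *"with the decay rate δ₀"* is to be read. [folklore] -/
theorem conv_prefactor_witness (δ : ℝ) (n : ℕ) :
    ∑ z ∈ Finset.range (n + 1), Real.exp (-(δ * z)) * Real.exp (-(δ * ((n : ℝ) - z))) =
      ((n : ℝ) + 1) * Real.exp (-(δ * n)) := by
  have h : ∀ z ∈ Finset.range (n + 1),
      Real.exp (-(δ * z)) * Real.exp (-(δ * ((n : ℝ) - z))) = Real.exp (-(δ * n)) := by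
    intro z _
    rw [← Real.exp_add]
    congr 1
    ring
  rw [Finset.sum_congr rfl h, Finset.sum_const, Finset.card_range, nsmul_eq_mul]
  push_cast
  ring

end Lattice

/-! ## §3  Matrices on `B4.Idx Ω N` (the index set of [3]) and on embedded variable sets -/

section Matrices

variable {d N : ℕ} {Ω : Finset (Fin d → ℤ)}

/-- Σ over Ω × Fin N of a function of the position = N · Σ over Ω. [folklore] -/
theorem sum_idx_eq (f : (Fin d → ℤ) → ℝ) :
    ∑ q : B4.Idx Ω N, f (q.1 : Fin d → ℤ) = N * ∑ z ∈ Ω, f z := by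
  rw [Fintype.sum_prod_type]
  simp only [Finset.sum_const, Finset.card_univ, Fintype.card_fin, nsmul_eq_mul]
  rw [← Finset.mul_sum, Finset.sum_coe_sort Ω f]

/-- Σ_{q ∈ Ω × Fin N} e^{−a|x − q₁|} ≤ N·C(d, a). [folklore] -/
theorem sum_idx_exp_dist_le (x : Fin d → ℤ) {a : ℝ} (ha : 0 < a) :
    ∑ q : B4.Idx Ω N, Real.exp (-(a * dist x (q.1 : Fin d → ℤ))) ≤ N * latticeConst d a := by
  rw [sum_idx_eq (fun z => Real.exp (-(a * dist x z)))]
  exact mul_le_mul_of_nonneg_left (sum_exp_dist_le Ω x ha) (Nat.cast_nonneg N)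

/-- Σ_{q ∈ Ω × Fin N} e^{−δ|p₁ − q₁|}e^{−δ|q₁ − r₁|} ≤ N·C(d, δ − δ′)·e^{−δ′|p₁ − r₁|}. [folklore] -/
theorem sum_idx_conv_le (x y : Fin d → ℤ) {δ δ' : ℝ} (hδ' : 0 ≤ δ') (h : δ' < δ) :
    ∑ q : B4.Idx Ω N, Real.exp (-(δ * dist x (q.1 : Fin d → ℤ))) * Real.exp (-(δ * dist (q.1 : Fin d → ℤ) y)) ≤
      N * latticeConst d (δ - δ') * Real.exp (-(δ' * dist x y)) := by
  rw [sum_idx_eq (fun z => Real.exp (-(δ * dist x z)) * Real.exp (-(δ * dist z y))), mul_assoc]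
  exact mul_le_mul_of_nonneg_left (conv_exp_dist_le Ω x y hδ' h) (Nat.cast_nonneg N)

/-- KERNEL-CHECKED: the product of two matrices on L²(Ω; ℝ^N) with kernels decaying at rate δ has a kernel decaying
at any rate δ′ < δ, |(AB)(p, r)| ≤ c₁c₂·N·C(d, δ − δ′)·e^{−δ′|p₁ − r₁|}, the constant uniform in Ω. [folklore] -/
theorem mul_decay {A B : Matrix (B4.Idx Ω N) (B4.Idx Ω N) ℝ} {c₁ c₂ δ δ' : ℝ} (hc₁ : 0 ≤ c₁) (hc₂ : 0 ≤ c₂)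
    (hδ' : 0 ≤ δ') (h : δ' < δ)
    (hA : ∀ p q, |A p q| ≤ c₁ * Real.exp (-(δ * dist (p.1 : Fin d → ℤ) (q.1 : Fin d → ℤ))))
    (hB : ∀ p q, |B p q| ≤ c₂ * Real.exp (-(δ * dist (p.1 : Fin d → ℤ) (q.1 : Fin d → ℤ))))
    (p r : B4.Idx Ω N) :
    |(A * B) p r| ≤ c₁ * c₂ * (N * latticeConst d (δ - δ')) *
      Real.exp (-(δ' * dist (p.1 : Fin d → ℤ) (r.1 : Fin d → ℤ))) := by
  rw [Matrix.mul_apply]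
  calc |∑ q, A p q * B q r| ≤ ∑ q : B4.Idx Ω N, |A p q * B q r| := Finset.abs_sum_le_sum_abs _ _
    _ ≤ ∑ q : B4.Idx Ω N, (c₁ * Real.exp (-(δ * dist (p.1 : Fin d → ℤ) (q.1 : Fin d → ℤ)))) *
          (c₂ * Real.exp (-(δ * dist (q.1 : Fin d → ℤ) (r.1 : Fin d → ℤ)))) := by
        refine Finset.sum_le_sum fun q _ => ?_
        rw [abs_mul]
        exact mul_le_mul (hA p q) (hB q r) (abs_nonneg _) (mul_nonneg hc₁ (Real.exp_pos _).le)
    _ = c₁ * c₂ * ∑ q : B4.Idx Ω N, Real.exp (-(δ * dist (p.1 : Fin d → ℤ) (q.1 : Fin d → ℤ))) *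
          Real.exp (-(δ * dist (q.1 : Fin d → ℤ) (r.1 : Fin d → ℤ))) := by
        rw [Finset.mul_sum]
        exact Finset.sum_congr rfl fun q _ => by ring
    _ ≤ c₁ * c₂ * (N * latticeConst d (δ - δ') * Real.exp (-(δ' * dist (p.1 : Fin d → ℤ) (r.1 : Fin d → ℤ)))) :=
        mul_le_mul_of_nonneg_left (sum_idx_conv_le (p.1 : Fin d → ℤ) (r.1 : Fin d → ℤ) hδ' h)
          (mul_nonneg hc₁ hc₂)
    _ = _ := by ring

/-- A sum of non-negative terms over an embedded variable set is at most the sum over all of Ω × Fin N. [folklore] -/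
theorem sum_embedding_le {S : Type} [Fintype S] (ι : S ↪ B4.Idx Ω N) {f : B4.Idx Ω N → ℝ}
    (hf : ∀ q, 0 ≤ f q) : ∑ y : S, f (ι y) ≤ ∑ q : B4.Idx Ω N, f q := by
  rw [← Finset.sum_map Finset.univ ι f]
  exact Finset.sum_le_sum_of_subset_of_nonneg (Finset.subset_univ _) fun q _ _ => hf q

/-- KERNEL-CHECKED, the form used at B6's sites (variables on a finite set S placed injectively in Ω × Fin N, as in
`B6WeightedEncoding.WSite`): |(M₁M₂)(y, y′)| ≤ c₁c₂·N·C(d, δ − δ′)·e^{−δ′|ιy − ιy′|} whenever |M₁(y, y′)|,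
|M₂(y, y′)| ≤ c_k e^{−δ|ιy − ιy′|}.  Iterating gives the decay of any finite composition (e.g. Q′G′^ξ(□̃)²Q′* at
p. 237, (QG_□Q*)↾_□ at p. 248) from the decay of its factors, at the price of the rate. [cite: Balaban1984PropagatorsII, p.237] -/
theorem mul_decay_of_embedding {S : Type} [Fintype S] (ι : S ↪ B4.Idx Ω N) {M₁ M₂ : Matrix S S ℝ}
    {c₁ c₂ δ δ' : ℝ} (hc₁ : 0 ≤ c₁) (hc₂ : 0 ≤ c₂) (hδ' : 0 ≤ δ') (h : δ' < δ)
    (h₁ : ∀ y y', |M₁ y y'| ≤ c₁ * Real.exp (-(δ * dist ((ι y).1 : Fin d → ℤ) ((ι y').1 : Fin d → ℤ))))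
    (h₂ : ∀ y y', |M₂ y y'| ≤ c₂ * Real.exp (-(δ * dist ((ι y).1 : Fin d → ℤ) ((ι y').1 : Fin d → ℤ))))
    (y y' : S) :
    |(M₁ * M₂) y y'| ≤ c₁ * c₂ * (N * latticeConst d (δ - δ')) *
      Real.exp (-(δ' * dist ((ι y).1 : Fin d → ℤ) ((ι y').1 : Fin d → ℤ))) := by
  rw [Matrix.mul_apply]
  calc |∑ z, M₁ y z * M₂ z y'| ≤ ∑ z, |M₁ y z * M₂ z y'| := Finset.abs_sum_le_sum_abs _ _
    _ ≤ ∑ z, (c₁ * Real.exp (-(δ * dist ((ι y).1 : Fin d → ℤ) ((ι z).1 : Fin d → ℤ)))) *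
          (c₂ * Real.exp (-(δ * dist ((ι z).1 : Fin d → ℤ) ((ι y').1 : Fin d → ℤ)))) := by
        refine Finset.sum_le_sum fun z _ => ?_
        rw [abs_mul]
        exact mul_le_mul (h₁ y z) (h₂ z y') (abs_nonneg _) (mul_nonneg hc₁ (Real.exp_pos _).le)
    _ = c₁ * c₂ * ∑ z : S, Real.exp (-(δ * dist ((ι y).1 : Fin d → ℤ) ((ι z).1 : Fin d → ℤ))) *
          Real.exp (-(δ * dist ((ι z).1 : Fin d → ℤ) ((ι y').1 : Fin d → ℤ))) := by
        rw [Finset.mul_sum]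
        exact Finset.sum_congr rfl fun z _ => by ring
    _ ≤ c₁ * c₂ * ∑ q : B4.Idx Ω N, Real.exp (-(δ * dist ((ι y).1 : Fin d → ℤ) (q.1 : Fin d → ℤ))) *
          Real.exp (-(δ * dist (q.1 : Fin d → ℤ) ((ι y').1 : Fin d → ℤ))) :=
        mul_le_mul_of_nonneg_left
          (sum_embedding_le ι
            (f := fun q => Real.exp (-(δ * dist ((ι y).1 : Fin d → ℤ) (q.1 : Fin d → ℤ))) *
              Real.exp (-(δ * dist (q.1 : Fin d → ℤ) ((ι y').1 : Fin d → ℤ))))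
            fun q => mul_nonneg (Real.exp_pos _).le (Real.exp_pos _).le)
          (mul_nonneg hc₁ hc₂)
    _ ≤ c₁ * c₂ * (N * latticeConst d (δ - δ') *
          Real.exp (-(δ' * dist ((ι y).1 : Fin d → ℤ) ((ι y').1 : Fin d → ℤ)))) :=
        mul_le_mul_of_nonneg_left (sum_idx_conv_le ((ι y).1 : Fin d → ℤ) ((ι y').1 : Fin d → ℤ) hδ' h)
          (mul_nonneg hc₁ hc₂)
    _ = _ := by ring

/-- The row sums of a decaying kernel are bounded uniformly in Ω: Σ_q |A(p, q)| ≤ c·N·C(d, δ) — the ℓ^∞ (and, by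
symmetry, ℓ¹, hence ℓ²-Schur) operator-norm bound that B6 uses silently when passing from kernel bounds to norm
bounds (census C-B6-3: *"the kernel→ℓ² (Schur) conversion is not displayed (routine)"*). [folklore] -/
theorem row_sum_le {A : Matrix (B4.Idx Ω N) (B4.Idx Ω N) ℝ} {c δ : ℝ} (hc : 0 ≤ c) (hδ : 0 < δ)
    (hA : ∀ p q, |A p q| ≤ c * Real.exp (-(δ * dist (p.1 : Fin d → ℤ) (q.1 : Fin d → ℤ)))) (p : B4.Idx Ω N) :
    ∑ q, |A p q| ≤ c * (N * latticeConst d δ) := by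
  calc ∑ q, |A p q| ≤ ∑ q : B4.Idx Ω N, c * Real.exp (-(δ * dist (p.1 : Fin d → ℤ) (q.1 : Fin d → ℤ))) :=
        Finset.sum_le_sum fun q _ => hA p q
    _ = c * ∑ q : B4.Idx Ω N, Real.exp (-(δ * dist (p.1 : Fin d → ℤ) (q.1 : Fin d → ℤ))) := by
        rw [Finset.mul_sum]
    _ ≤ c * (N * latticeConst d δ) :=
        mul_le_mul_of_nonneg_left (sum_idx_exp_dist_le (p.1 : Fin d → ℤ) hδ) hc

end Matrices

/-! ## §4  Kernel bound ⇒ ℓ² operator bound, uniform in the region (via the tree's Schur test)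

Census C-B6-3 records that B6 passes from kernel bounds to operator-norm bounds without display (*"the kernel→ℓ²
(Schur) conversion is not displayed (routine)"*).  The conversion is the finite Schur test, ALREADY kernel-checked in
the tree as `SchurTest.sum_sq_le` (unit `b2b-balaban-adv1`, for B9 (3.46)); this section only supplies the uniform
row/column sums of a decaying kernel on `B4.Idx Ω N` and applies it (v1.2: the v1.1 restatements `sq_sum_mul_le` /
`schur_test` of that lemma are withdrawn in favour of the import — no duplicate in the tree). -/


section SchurDecay

variable {d N : ℕ} {Ω : Finset (Fin d → ℤ)}

/-- Column sums of a decaying kernel are bounded like its row sums (the sup-distance is symmetric). [folklore] -/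
theorem col_sum_le {A : Matrix (B4.Idx Ω N) (B4.Idx Ω N) ℝ} {c δ : ℝ} (hc : 0 ≤ c) (hδ : 0 < δ)
    (hA : ∀ p q, |A p q| ≤ c * Real.exp (-(δ * dist (p.1 : Fin d → ℤ) (q.1 : Fin d → ℤ)))) (q : B4.Idx Ω N) :
    ∑ p, |A p q| ≤ c * (N * latticeConst d δ) := by
  calc ∑ p, |A p q| ≤ ∑ p : B4.Idx Ω N, c * Real.exp (-(δ * dist (q.1 : Fin d → ℤ) (p.1 : Fin d → ℤ))) :=
        Finset.sum_le_sum fun p _ => by rw [dist_comm]; exact hA p q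
    _ = c * ∑ p : B4.Idx Ω N, Real.exp (-(δ * dist (q.1 : Fin d → ℤ) (p.1 : Fin d → ℤ))) := by
        rw [Finset.mul_sum]
    _ ≤ c * (N * latticeConst d δ) :=
        mul_le_mul_of_nonneg_left (sum_idx_exp_dist_le (q.1 : Fin d → ℤ) hδ) hc

/-- KERNEL-CHECKED: a kernel on L²(Ω; ℝ^N) with |A(p, q)| ≤ c·e^{−δ|p₁−q₁|} defines an operator of ℓ²-norm at most
c·N·C(d, δ), UNIFORMLY in Ω: ‖Ax‖₂² ≤ (c·N·C(d, δ))²‖x‖₂² (row/column sums `row_sum_le`/`col_sum_le` + the tree's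
Schur test `SchurTest.sum_sq_le`).  This is the undisplayed "kernel bound ⇒ operator bound" step of B6 §2 (census
C-B6-3). [folklore] -/
theorem mulVec_sq_le_of_decay {A : Matrix (B4.Idx Ω N) (B4.Idx Ω N) ℝ} {c δ : ℝ} (hc : 0 ≤ c) (hδ : 0 < δ)
    (hA : ∀ p q, |A p q| ≤ c * Real.exp (-(δ * dist (p.1 : Fin d → ℤ) (q.1 : Fin d → ℤ))))
    (x : B4.Idx Ω N → ℝ) :
    ∑ p, (A.mulVec x p) ^ 2 ≤ (c * (N * latticeConst d δ)) ^ 2 * ∑ q, x q ^ 2 := by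
  rw [sq]
  exact SchurTest.sum_sq_le (fun p q => A p q) x (row_sum_le hc hδ hA) (col_sum_le hc hδ hA)

end SchurDecay

end Literature.MathematicalPhysics.QuantumFieldTheory.Balaban1983to89.B6KernelComposition
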